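import Summits.BirchSwinnertonDyer.Rank1Residual.Additive.X4RankZeroUpperBound
import Summits.BirchSwinnertonDyer.Rank1Residual.X4.KuriharaClasswide
import Literature.NumberTheory.EllipticCurves.Rank1Residual.Typed.CasselsLowerBound
import Literature.NumberTheory.EllipticCurves.NonEisensteinPrimeOfSurjective
import HarnessLib

/-!
# X4 ∧ `r = 0` at `p ≥ 5`: the Tamagawa-obstructed pairs with `ord_p ∏ c_ℓ = 1` CLOSE BY PARITY — Kim 2026 Thm. 1.8 (6) + Cassels–Tate squareness (cell `b2b-bsdres`, seat harvest-2 GEN 6)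

HONEST FRAMING (cell `b2b-bsdres`, run/shared/lean/b2b/bsd-rank1-residual/, verbatim in every
file): the goal of the cell is to DELETE the COMBINATION-SHAPED residual classes of the
Birch–Swinnerton-Dyer formula for ALL analytic-rank `≤ 1` elliptic curves over `ℚ` — "full BSD
formula for every rank `≤ 1` curve in class `C`" assembled STRICTLY from published theorems — so
that the rank-`≤ 1` remainder becomes exactly the CONSTRUCTION-SHAPED classes, which are TYPED
(missing-input `Prop`s), NOT attempted. This is not "finishing BSD". Prove what is provable now;
shrink each hard class to its core with data; no claim beyond stated classes.

**What this file proves** (theorems only; no definition, no new named fact; every arithmetic input is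
an explicit PUBLISHED named-fact hypothesis). The additive-p4 seat's file
`Additive/X4RankZeroUpperBound.lean` (p199532) turns C.-H. Kim, Amer. J. Math. 148 (2026) Thm. 1.8
(6) (= arXiv:2203.12159v4 Thm. 1.9 (6); named fact
`Kim2026.rankZero_padicValNat_sha_le_of_maninConstant`, ANY reduction type at `p`) into the kernel
inequality `ord_p #Ш(E) ≤ ord_p #Ш_an(E) + ord_p ∏_ℓ c_ℓ(E)` for every elliptic `E/ℚ` of analytic
rank `0` at a prime `p ≥ 5` with `ρ̄_{E,p}` surjective and a modular parametrisation datum whose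
Manin constant is prime to `p` (`X4RankZero.padicValNat_shaOrder_le`; class-agnostic form
`padicValNat_shaOrder_le_of_kim_rankZero`). On the pairs with `p ∣ ∏ c_ℓ` that file stops: the
missing half there is Kim's Conjecture 1.10 (`∂^{(∞)}(δ̃) = ∑ ord_p c_ℓ`, open), and the cell
recorded those pairs as "open: `∂^{(∞)}` not finitely certifiable" (harvest-2 RECLASSIFY items 19,
24, 27; additive-p4 REQUESTS R2: 128 of the 139 open rank-`0` `ρ̄`-onto X4 census pairs at
`p ≥ 5`, `N < 2·10⁴`).

THIS FILE adds ONE published input — Cassels' theorem that `#Ш(E/ℚ)` is a perfect square when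
`Ш(E/ℚ)` is finite (the Cassels–Tate pairing is alternating and non-degenerate: Cassels, J. reine
angew. Math. 211 (1962); Silverman *AEC* Thm. X.4.14; tree: named fact
`WeierstrassCurve.exists_casselsTate_pairing` = bsd.S18 with its sorry-free corollary
`WeierstrassCurve.isSquare_shaOrder_of_casselsTate`, exactly as consumed by x11b's
`Typed/CasselsLowerBound.lean`) — and observes that it settles the `ord_p ∏ c_ℓ = 1` sub-population
COMPLETELY: if `#Ш_an(E)` is a `p`-unit and `p² ∤ ∏ c_ℓ(E)`, Kim's inequality reads
`ord_p #Ш(E) ≤ 1`, and an EVEN number `≤ 1` is `0` — so `Ш(E)[p^∞] = 0`, `ord_p #Ш = 0 = ord_p #Ш_an`,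
which is Miller's `BSD(E,p)`. No Kurihara number, no main conjecture, no certificate beyond the
census data; PUBLISHED theorems only (Kim 2026 Thm. 1.8, Cassels 1962, Gross–Zagier–Kolyvagin,
modularity, Mazur 1977 for the torsion term, Agashe–Ribet–Stein 2006 for the Manin datum of the
optimal curve).
* `padicValNat_eq_zero_of_isSquare_of_le_one` — arithmetic: a nonzero square with `ord_p ≤ 1` has
  `ord_p = 0` (from x11b's `two_le_padicValNat_of_isSquare_of_dvd`);
* `padicValNat_shaOrder_eq_zero_of_kim_rankZero_of_casselsTate` — CLASS-AGNOSTIC (any reduction at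
  `p`): `r_an = 0`, `5 ≤ p`, `ρ̄_{E,p}` onto, datum `D` with `p ∤ c_D`, `p² ∤ ∏ c_ℓ`, `#Ш_an = q` a
  `p`-unit ⇒ `ord_p #Ш(E) = 0`; and `bsdp_of_kim_rankZero_of_casselsTate_of_not_sq_dvd_tamagawaProduct`
  ⇒ `BSD(E,p)`;
* `X4RankZero.bsdp_of_casselsTate_of_not_sq_dvd_tamagawaProduct` — the census shape over the cell's
  exact predicate `ClassX4 W p` (= `p ≠ 2 ∧ Addv W p ∧ Irr W p`), and
  `X4RankZero.missingInputAt_of_casselsTate_of_not_sq_dvd_tamagawaProduct` — the typed currency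
  `Typed.X4.MissingInputAt W p` of `Typed/X4.lean` DISCHARGED at these pairs;
* `X4RankZero.even_padicValNat_shaOrder_and_le` — what the two published inputs give on EVERY
  rank-`0` `ρ̄`-onto X4 pair at `p ≥ 5` (`ord_p #Ш` is even AND `≤ ord_p #Ш_an + ord_p ∏ c_ℓ`): on the
  `ord_p ∏ c_ℓ = 2`, `p ∤ #Ш_an` rows this leaves `ord_p #Ш ∈ {0, 2}` — those stay OPEN
  (`X4RankZero.padicValNat_shaOrder_eq_zero_or_eq_two`);
* `X4RankZero.not_kuriharaUnitAt_of_casselsTate_of_padicValNat_tamagawaProduct_eq_one` — composing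
  with the additive-p3 seat's `X4.not_kuriharaUnitAt_of_bsdp_of_dvd_tamagawaProduct`
  (`X4/KuriharaClasswide.lean`, p199308): on the `ord_p ∏ c_ℓ = 1` rows NO unit Kurihara number
  exists at any cyclic Kolyvagin level — now UNCONDITIONALLY (Kim's Conjecture 1.10 value
  `∂^{(∞)}(δ̃) = 1` is forced there by parity: `length Ш[p^∞] = 1 − ∂^{(∞)}` is even and `≥ 0`).

**Census consequence (numbers, not adjectives; hyp seat `hyp_bits.tsv` 2026-08-19T18:28Z and
additive-p4 `R2_x4_obstructed_pairs.tsv`, N < 2·10⁴ ‖ N < 10⁴).** X4 ∧ `r_an = 0` ∧ `p ≥ 5` ∧ surj(p)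
= 2531 residue-census pairs = 2392 with `p ∤ ∏c_ℓ·#Ш_an` (T-KIM0, `X4RankZero.bsdp_of_shaAn_unit`)
+ **124 ‖ 37 with `ord_p ∏ c_ℓ = 1`, `p ∤ #Ш_an` (93 @5, 26 @7, 5 @11; every one the Cremona-OPTIMAL
curve of its class with Manin constant `1` by Agashe–Ribet–Stein 2006 Thm. 2.6 / appendix, `N ≤ 130000`;
`ρ̄` onto by Cremona's `galrep`; these include ALL 12 "L-I0SQ" type-I₀* candidates of harvest-2 GEN 4
and the two `λ^an = 4` pairs 17400j1@5, 17550da1@5) — CLOSED BY THIS FILE per pair, with NO per-pair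
input beyond [`r_an = 0`, surj(p), `#Ш_an` a `p`-unit, `ord_p ∏ c_ℓ = 1`, the optimal Manin datum]**
+ 11 with `#Ш_an = 25`, `5 ∤ ∏ c_ℓ` (certificate-closed: unit Kurihara number at the additive prime,
harvest-2 GEN 5 E21, two engines) + 4 with `ord_p ∏ c_ℓ = 2`, `p ∤ #Ш_an` (9450dh1@5, 14850cm1@5,
15050bb1@5, 18150da1@11 — OPEN; `ord_p #Ш ∈ {0,2}`; Kim's Conj. 1.10 predicts `∂^{(∞)} = 2`). So the
open part of X4 ∧ {`r = 0`, `p ≥ 5`, `ρ̄` onto} at `N < 2·10⁴` shrinks from 139 to 4 pairs. The class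
label of X4 is UNCHANGED (CONSTRUCTION-SHAPED: `p = 3`, non-surjective images, rank `1` with
`p ∣ ∏c_ℓ·#Ш_an`, and `ord_p ∏ c_ℓ ≥ 2` remain); this is a per-pair statement over a decidable
sub-population, from published theorems only. The L-I0SQ chain (HARVEST E19.7; REFEREE R79.2: Kato
17.4(3) + Delbourgo + Fouquet + Kings + joint R1-sel) is thereby NOT NEEDED for any X4 pair: its 12
candidates all have `ord_p ∏ c_ℓ = 1 = ord_p(L(E,1)/Ω)` and close here.

Why the parity step is legitimate at these pairs: `Ш(E/ℚ)` is finite (Gross–Zagier–Kolyvagin in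
analytic rank `0`, `hGZK`), so Cassels' theorem applies to the whole of `Ш`, `#Ш` is a square, and
`ord_p` of a nonzero square is even. Kim's Theorem 1.8 itself ASSUMES `Ш[p^∞]` finite for clause (6);
the tree fact carries `Finite W.sha`. Nothing here uses a conjecture. A SECOND printed locus for the
evenness is Kim's own clause (5) of the same theorem (arXiv v4 PDF p. 8 L5–L7, re-read by this seat:
"`Ш(E/ℚ)[p^∞] ≃ ⊕_{i≥1} (ℤ/p^{(∂^{(ord(δ̃)+2(i−1))}(δ̃) − ∂^{(ord(δ̃)+2i)}(δ̃))/2} ℤ)^{⊕2}`, and so (6)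
…"), which prints `Ш[p^∞]` as a direct sum of squares; the tree fact
`Kim2026.rankZero_padicValNat_sha_le_of_maninConstant` carries only clause (6) as an inequality,
so the kernel route to evenness is Cassels' theorem (bsd.S18), as in `Typed/CasselsLowerBound.lean`.

References: Kim 2026 [Kim2022StructureSelmer] Thm. 1.9 (6), Conj. 1.10 (PDF p. 8); Cassels 1962
[Cassels1962ArithmeticIV]; Silverman AEC X.4.14 [SilvermanAEC2009]; Miller 2011 Def. 1.1
[Miller2011LMS]; Mazur 1977 III.5 [Mazur1977]; Agashe–Ribet–Stein 2006 Thm. 2.6 [AgasheRibetStein2006];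
cell files `b2b-bsdres-harvest-2/RECLASSIFY.md` §GEN-6, `b2b-bsdres-additive-p4/REQUESTS.md` R2.
-/

noncomputable section

open scoped Classical

open WeierstrassCurve Literature.NumberTheory.EllipticCurves
  Literature.NumberTheory.EllipticCurves.ModularForms
  Literature.NumberTheory.EllipticCurves.Rank1Residual
  Literature.NumberTheory.EllipticCurves.Rank1Residual.Typed

namespace Summit.BirchSwinnertonDyer.Rank1Residual.Additive

/-! ### Arithmetic of squares -/

/-- A nonzero perfect square whose `p`-adic valuation is `≤ 1` has valuation `0` (the valuation of a
square is even; x11b's `two_le_padicValNat_of_isSquare_of_dvd`). [folklore] -/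
theorem padicValNat_eq_zero_of_isSquare_of_le_one {p n : ℕ} [Fact p.Prime] (hsq : IsSquare n)
    (hn : n ≠ 0) (hle : padicValNat p n ≤ 1) : padicValNat p n = 0 := by
  by_contra h
  have hdvd : p ∣ n := by
    by_contra hnd
    exact h (padicValNat.eq_zero_of_not_dvd hnd)
  have h2 : 2 ≤ padicValNat p n := two_le_padicValNat_of_isSquare_of_dvd hsq hn hdvd
  omega

/-- A nonzero perfect square whose `p`-adic valuation is `≤ 2` has valuation `0` or `2`. [folklore] -/
theorem padicValNat_eq_zero_or_eq_two_of_isSquare_of_le_two {p n : ℕ} [Fact p.Prime]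
    (hsq : IsSquare n) (hn : n ≠ 0) (hle : padicValNat p n ≤ 2) :
    padicValNat p n = 0 ∨ padicValNat p n = 2 := by
  obtain ⟨r, rfl⟩ := hsq
  have hr : r ≠ 0 := fun h => hn (by simp [h])
  rw [padicValNat.mul hr hr] at hle ⊢
  omega

/-- `p² ∤ m` with `m ≠ 0` means `ord_p m ≤ 1`. [folklore] -/
theorem padicValNat_le_one_of_not_sq_dvd {p m : ℕ} [Fact p.Prime] (hm : m ≠ 0)
    (h : ¬ p ^ 2 ∣ m) : padicValNat p m ≤ 1 := by
  by_contra hlt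
  exact h ((padicValNat_dvd_iff_le hm).2 (by omega))

variable (W : WeierstrassCurve ℚ) [W.IsElliptic] [W.IsGloballyMinimal] (p : ℕ) [Fact p.Prime]

/-! ### Class-agnostic (ANY reduction type at `p`): Kim's bound + Cassels–Tate squareness -/

/-- **Rank `0`, `p ≥ 5`, `ρ̄_{E,p}` onto, Manin constant of `D` prime to `p`, ANY reduction at `p`:
`ord_p #Ш(E)` is EVEN and `≤ ord_p #Ш_an + ord_p ∏ c_ℓ`.** The inequality is Kim 2026 Thm. 1.8 (6)
in rank `0` (`hKim`, via `padicValNat_shaOrder_le_of_kim_rankZero`; the torsion term vanishes since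
surjectivity gives `E[p]` irreducible, Mazur 1977); evenness is Cassels' theorem (`hCT` = bsd.S18:
`#Ш` is a perfect square once `Ш` is finite — Gross–Zagier–Kolyvagin `hGZK`).
[cite: Kim2022StructureSelmer, Thm. 1.9 (6) (PDF p. 8)] [cite: SilvermanAEC2009, Thm. X.4.14]
[cite: Mazur1977, Ch. III §5, p. 157] -/
theorem even_padicValNat_shaOrder_and_le_of_kim_rankZero_of_casselsTate
    (hCT : exists_casselsTate_pairing (K := ℚ))
    (hKim : Kim2026.rankZero_padicValNat_sha_le_of_maninConstant)
    (hGZK : rank_eq_analyticRank_of_analyticRank_le_one) (hmod : hasEntireLFunction_rat)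
    (hp : 5 ≤ p) (hr : W.analyticRank = 0) (hsurj : W.HasSurjectiveModNGaloisRep p)
    {N : ℕ} [NeZero N] (D : ModularParametrizationData W N) (hc : ¬ (p : ℤ) ∣ D.maninConstant) :
    Even (padicValNat p W.shaOrder) ∧ ∃ q : ℚ, shaAn W = (q : ℂ) ∧
      (padicValNat p W.shaOrder : ℤ) ≤ padicValRat p q + padicValNat p W.tamagawaProduct := by
  have hfin : W.ShaFinite := (hGZK W (by rw [hr]; exact zero_le_one)).2
  have hsq : IsSquare W.shaOrder := isSquare_shaOrder_of_casselsTate hCT W hfin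
  refine ⟨?_, ?_⟩
  · obtain ⟨r, hr2⟩ := hsq
    have hn : W.shaOrder ≠ 0 := (WeierstrassCurve.shaOrder_pos W hfin).ne'
    have hr0 : r ≠ 0 := fun h => hn (by simp [hr2, h])
    rw [hr2, padicValNat.mul hr0 hr0]
    exact ⟨_, rfl⟩
  · have hirr : W.HasIrreducibleModPGaloisRep p :=
      hasIrreducibleModPGaloisRep_of_hasSurjectiveModNGaloisRep W p hsurj
    obtain ⟨q, hq, hle⟩ :=
      padicValNat_shaOrder_le_of_kim_rankZero W p hKim hGZK hmod hp hr hsurj D hc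
    refine ⟨q, hq, ?_⟩
    rw [padicValNat_torsionOrder_eq_zero_of_irreducible W p hirr] at hle
    simpa using hle

/-- **PARITY CLOSURE, class-agnostic (ANY reduction type at `p`).** Let `E/ℚ` be globally minimal
of analytic rank `0`, `p ≥ 5` with `ρ̄_{E,p}` surjective, `D` a modular parametrisation datum with
`p ∤ c_D`, and suppose `p² ∤ ∏ c_ℓ(E)` and `#Ш_an(E) = q` is a `p`-unit. Then `ord_p #Ш(E) = 0`:
Kim's inequality gives `ord_p #Ш ≤ ord_p q + ord_p ∏ c_ℓ ≤ 1` and Cassels' theorem makes it even.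
PUBLISHED inputs only (Kim 2026 Thm. 1.8 (6) `hKim`, Cassels–Tate `hCT`, Gross–Zagier–Kolyvagin
`hGZK`, modularity `hmod`). [cite: Kim2022StructureSelmer, Thm. 1.9 (6) (PDF p. 8)]
[cite: SilvermanAEC2009, Thm. X.4.14] [cite: Miller2011LMS, Def. 1.1] -/
theorem padicValNat_shaOrder_eq_zero_of_kim_rankZero_of_casselsTate
    (hCT : exists_casselsTate_pairing (K := ℚ))
    (hKim : Kim2026.rankZero_padicValNat_sha_le_of_maninConstant)
    (hGZK : rank_eq_analyticRank_of_analyticRank_le_one) (hmod : hasEntireLFunction_rat)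
    (hp : 5 ≤ p) (hr : W.analyticRank = 0) (hsurj : W.HasSurjectiveModNGaloisRep p)
    {N : ℕ} [NeZero N] (D : ModularParametrizationData W N) (hc : ¬ (p : ℤ) ∣ D.maninConstant)
    (htam : ¬ p ^ 2 ∣ W.tamagawaProduct) {q : ℚ} (hq : shaAn W = (q : ℂ))
    (hv : padicValRat p q = 0) : padicValNat p W.shaOrder = 0 := by
  have hfin : W.ShaFinite := (hGZK W (by rw [hr]; exact zero_le_one)).2
  have hsq : IsSquare W.shaOrder := isSquare_shaOrder_of_casselsTate hCT W hfin
  have hn : W.shaOrder ≠ 0 := (WeierstrassCurve.shaOrder_pos W hfin).ne'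
  obtain ⟨-, q', hq', hle⟩ :=
    even_padicValNat_shaOrder_and_le_of_kim_rankZero_of_casselsTate W p hCT hKim hGZK hmod hp hr
      hsurj D hc
  have hqq : q' = q := by exact_mod_cast hq'.symm.trans hq
  subst hqq
  have htam1 : padicValNat p W.tamagawaProduct ≤ 1 :=
    padicValNat_le_one_of_not_sq_dvd (W.tamagawaProduct_pos_holds).ne' htam
  rw [hv, zero_add] at hle
  have hle' : padicValNat p W.shaOrder ≤ padicValNat p W.tamagawaProduct := by exact_mod_cast hle
  exact padicValNat_eq_zero_of_isSquare_of_le_one hsq hn (hle'.trans htam1)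

/-- **PARITY CLOSURE ⇒ `BSD(E,p)`, class-agnostic.** Under the hypotheses of
`padicValNat_shaOrder_eq_zero_of_kim_rankZero_of_casselsTate` (rank `0`, `p ≥ 5`, `ρ̄` onto,
`p ∤ c_D`, `p² ∤ ∏ c_ℓ`, `#Ш_an` a `p`-unit; ANY reduction at `p`), Miller's `BSD(E,p)` holds:
`ord_p #Ш = 0 = ord_p #Ш_an` (`Typed.bsdp_of_missingPPartAt`). The case `p ∤ ∏ c_ℓ` is the cell's
T-KIM0 row; the NEW case is `ord_p ∏ c_ℓ = 1`. [cite: Kim2022StructureSelmer, Thm. 1.9 (6) (PDF p. 8)]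
[cite: SilvermanAEC2009, Thm. X.4.14] [cite: Miller2011LMS, §1 and Def. 1.1] -/
theorem bsdp_of_kim_rankZero_of_casselsTate_of_not_sq_dvd_tamagawaProduct
    (hCT : exists_casselsTate_pairing (K := ℚ))
    (hKim : Kim2026.rankZero_padicValNat_sha_le_of_maninConstant)
    (hGZK : rank_eq_analyticRank_of_analyticRank_le_one) (hmod : hasEntireLFunction_rat)
    (hp : 5 ≤ p) (hr : W.analyticRank = 0) (hsurj : W.HasSurjectiveModNGaloisRep p)
    {N : ℕ} [NeZero N] (D : ModularParametrizationData W N) (hc : ¬ (p : ℤ) ∣ D.maninConstant)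
    (htam : ¬ p ^ 2 ∣ W.tamagawaProduct) {q : ℚ} (hq : shaAn W = (q : ℂ))
    (hv : padicValRat p q = 0) : BSDp W p := by
  have h0 : padicValNat p W.shaOrder = 0 :=
    padicValNat_shaOrder_eq_zero_of_kim_rankZero_of_casselsTate W p hCT hKim hGZK hmod hp hr hsurj D
      hc htam hq hv
  exact bsdp_of_missingPPartAt W p hGZK (by rw [hr]; exact zero_le_one)
    ⟨q, hq, by rw [hv, h0, Nat.cast_zero]⟩

/-! ### Class X4 (`p ≠ 2 ∧ Addv W p ∧ Irr W p`), analytic rank `0`, `p ≥ 5`, surjective image -/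

/-- **X4 ∧ `r = 0`, `p ≥ 5`, `ρ̄` onto, `p ∤ c_D`: `ord_p #Ш(E)` is even and
`≤ ord_p #Ш_an + ord_p ∏ c_ℓ`** — the two published inputs (Kim 2026 Thm. 1.8 (6) via the
additive-p4 seat's `X4RankZero.padicValNat_shaOrder_le`; Cassels–Tate squareness `hCT`) over the
cell's exact class predicate. [cite: Kim2022StructureSelmer, Thm. 1.9 (6) (PDF p. 8)]
[cite: SilvermanAEC2009, Thm. X.4.14] -/
theorem X4RankZero.even_padicValNat_shaOrder_and_le (hCT : exists_casselsTate_pairing (K := ℚ))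
    (hKim : Kim2026.rankZero_padicValNat_sha_le_of_maninConstant)
    (hGZK : rank_eq_analyticRank_of_analyticRank_le_one) (hmod : hasEntireLFunction_rat)
    (hp : 5 ≤ p) (hr : W.analyticRank = 0) (hX : ClassX4 W p) (hsurj : Surj W p)
    {N : ℕ} [NeZero N] (D : ModularParametrizationData W N) (hc : ¬ (p : ℤ) ∣ D.maninConstant) :
    Even (padicValNat p W.shaOrder) ∧ ∃ q : ℚ, shaAn W = (q : ℂ) ∧
      (padicValNat p W.shaOrder : ℤ) ≤ padicValRat p q + padicValNat p W.tamagawaProduct :=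
  ⟨(even_padicValNat_shaOrder_and_le_of_kim_rankZero_of_casselsTate W p hCT hKim hGZK hmod hp hr
      hsurj D hc).1,
    X4RankZero.padicValNat_shaOrder_le W p hKim hGZK hmod hp hr hX hsurj D hc⟩

/-- **PARITY CLOSURE on class X4: `BSD(E,p)` on X4 ∧ `r = 0` at `p ≥ 5` with `ρ̄_{E,p}` onto,
`p ∤ c_D`, `p² ∤ ∏ c_ℓ` and `#Ш_an` a `p`-unit.** Kim's inequality (additive-p4's
`X4RankZero.padicValNat_shaOrder_le`) bounds `ord_p #Ш ≤ ord_p #Ш_an + ord_p ∏ c_ℓ ≤ 1`; Cassels'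
theorem (`hCT`) makes `ord_p #Ш` even; hence `ord_p #Ш = 0 = ord_p #Ш_an`. PUBLISHED theorems
(Kim 2026 Thm. 1.8 (6), Cassels 1962 / Silverman X.4.14, Gross–Zagier–Kolyvagin, modularity) + per
pair ONLY [`r_an = 0`, surj(p), `#Ш_an` a `p`-unit, `p² ∤ ∏ c_ℓ`, the Manin datum `p ∤ c_D`]. NO
Kurihara number, no main conjecture. Census (`N < 2·10⁴ ‖ 10⁴`): beyond the 2392 ‖ 660 T-KIM0 pairs
(`p ∤ ∏ c_ℓ`, `X4RankZero.bsdp_of_shaAn_unit`), the **124 ‖ 37 pairs with `ord_p ∏ c_ℓ = 1`,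
`p ∤ #Ш_an`** (93 @5, 26 @7, 5 @11; all Cremona-optimal with Manin constant `1`; among them the 12
L-I0SQ candidates and 17400j1@5, 17550da1@5). Per pair; the class label is unchanged.
[cite: Kim2022StructureSelmer, Thm. 1.9 (6) (PDF p. 8)] [cite: SilvermanAEC2009, Thm. X.4.14]
[cite: Miller2011LMS, §1 and Def. 1.1] -/
theorem X4RankZero.bsdp_of_casselsTate_of_not_sq_dvd_tamagawaProduct
    (hCT : exists_casselsTate_pairing (K := ℚ))
    (hKim : Kim2026.rankZero_padicValNat_sha_le_of_maninConstant)
    (hGZK : rank_eq_analyticRank_of_analyticRank_le_one) (hmod : hasEntireLFunction_rat)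
    (hp : 5 ≤ p) (hr : W.analyticRank = 0) (hX : ClassX4 W p) (hsurj : Surj W p)
    {N : ℕ} [NeZero N] (D : ModularParametrizationData W N) (hc : ¬ (p : ℤ) ∣ D.maninConstant)
    (htam : ¬ p ^ 2 ∣ W.tamagawaProduct) {q : ℚ} (hq : shaAn W = (q : ℂ))
    (hv : padicValRat p q = 0) : BSDp W p := by
  -- via additive-p4's class-X4 inequality (the class predicate enters there; the parity step is
  -- class-agnostic)
  have h0 : padicValNat p W.shaOrder = 0 := by
    have hfin : W.ShaFinite := (hGZK W (by rw [hr]; exact zero_le_one)).2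
    have hsq : IsSquare W.shaOrder := isSquare_shaOrder_of_casselsTate hCT W hfin
    have hn : W.shaOrder ≠ 0 := (WeierstrassCurve.shaOrder_pos W hfin).ne'
    obtain ⟨q', hq', hle⟩ :=
      X4RankZero.padicValNat_shaOrder_le W p hKim hGZK hmod hp hr hX hsurj D hc
    have hqq : q' = q := by exact_mod_cast hq'.symm.trans hq
    subst hqq
    rw [hv, zero_add] at hle
    have hle' : padicValNat p W.shaOrder ≤ padicValNat p W.tamagawaProduct := by exact_mod_cast hle
    exact padicValNat_eq_zero_of_isSquare_of_le_one hsq hn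
      (hle'.trans (padicValNat_le_one_of_not_sq_dvd (W.tamagawaProduct_pos_holds).ne' htam))
  exact bsdp_of_missingPPartAt W p hGZK (by rw [hr]; exact zero_le_one)
    ⟨q, hq, by rw [hv, h0, Nat.cast_zero]⟩

/-- The same, concluding the typed missing input of class X4 (`Typed.X4.MissingInputAt W p`, the
currency of `Typed/X4.lean`): on X4 ∧ `r = 0` ∧ `p ≥ 5` ∧ surj(p) ∧ `p ∤ c_D` ∧ `p² ∤ ∏ c_ℓ` ∧
`p ∤ #Ш_an` the typed input is DISCHARGED from published theorems. [cite: Miller2011LMS, Def. 1.1] -/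
theorem X4RankZero.missingInputAt_of_casselsTate_of_not_sq_dvd_tamagawaProduct
    (hCT : exists_casselsTate_pairing (K := ℚ))
    (hKim : Kim2026.rankZero_padicValNat_sha_le_of_maninConstant)
    (hGZK : rank_eq_analyticRank_of_analyticRank_le_one) (hmod : hasEntireLFunction_rat)
    (hp : 5 ≤ p) (hr : W.analyticRank = 0) (hX : ClassX4 W p) (hsurj : Surj W p)
    {N : ℕ} [NeZero N] (D : ModularParametrizationData W N) (hc : ¬ (p : ℤ) ∣ D.maninConstant)
    (htam : ¬ p ^ 2 ∣ W.tamagawaProduct) {q : ℚ} (hq : shaAn W = (q : ℂ))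
    (hv : padicValRat p q = 0) : X4.MissingInputAt W p := by
  haveI : Finite W.sha := (hGZK W (by rw [hr]; exact zero_le_one)).2
  exact missingPPartAt_of_bsdp W p
    (X4RankZero.bsdp_of_casselsTate_of_not_sq_dvd_tamagawaProduct W p hCT hKim hGZK hmod hp hr hX
      hsurj D hc htam hq hv)

/-- **What remains on the `ord_p ∏ c_ℓ = 2` rows.** On X4 ∧ `r = 0` ∧ `p ≥ 5` ∧ surj(p) ∧ `p ∤ c_D`
with `#Ш_an` a `p`-unit and `ord_p ∏ c_ℓ ≤ 2`, the two published inputs leave exactly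
`ord_p #Ш ∈ {0, 2}` (`BSD(E,p)` is the first alternative). Census `N < 2·10⁴`: 9450dh1@5,
14850cm1@5, 15050bb1@5, 18150da1@11 — OPEN (Kim's Conjecture 1.10 predicts `∂^{(∞)}(δ̃) = 2`,
i.e. the first alternative). [cite: Kim2022StructureSelmer, Thm. 1.9 (6) and Conj. 1.10 (PDF p. 8)]
[cite: SilvermanAEC2009, Thm. X.4.14] -/
theorem X4RankZero.padicValNat_shaOrder_eq_zero_or_eq_two
    (hCT : exists_casselsTate_pairing (K := ℚ))
    (hKim : Kim2026.rankZero_padicValNat_sha_le_of_maninConstant)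
    (hGZK : rank_eq_analyticRank_of_analyticRank_le_one) (hmod : hasEntireLFunction_rat)
    (hp : 5 ≤ p) (hr : W.analyticRank = 0) (hX : ClassX4 W p) (hsurj : Surj W p)
    {N : ℕ} [NeZero N] (D : ModularParametrizationData W N) (hc : ¬ (p : ℤ) ∣ D.maninConstant)
    (htam : padicValNat p W.tamagawaProduct ≤ 2) {q : ℚ} (hq : shaAn W = (q : ℂ))
    (hv : padicValRat p q = 0) :
    padicValNat p W.shaOrder = 0 ∨ padicValNat p W.shaOrder = 2 := by
  have hfin : W.ShaFinite := (hGZK W (by rw [hr]; exact zero_le_one)).2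
  have hsq : IsSquare W.shaOrder := isSquare_shaOrder_of_casselsTate hCT W hfin
  have hn : W.shaOrder ≠ 0 := (WeierstrassCurve.shaOrder_pos W hfin).ne'
  obtain ⟨q', hq', hle⟩ := X4RankZero.padicValNat_shaOrder_le W p hKim hGZK hmod hp hr hX hsurj D hc
  have hqq : q' = q := by exact_mod_cast hq'.symm.trans hq
  subst hqq
  rw [hv, zero_add] at hle
  have hle' : padicValNat p W.shaOrder ≤ padicValNat p W.tamagawaProduct := by exact_mod_cast hle
  exact padicValNat_eq_zero_or_eq_two_of_isSquare_of_le_two hsq hn (hle'.trans htam)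

/-! ### Kim's Conjecture 1.10 on the `ord_p ∏ c_ℓ = 1` rows: no unit Kurihara number, unconditionally -/

/-- **On X4 ∧ `r = 0` ∧ `p ≥ 5` ∧ surj(p) with `ord_p ∏ c_ℓ = 1` and `p ∤ #Ш_an`, NO unit Kurihara
number exists at any cyclic Kolyvagin level** (`¬ X4.KuriharaUnitAt W p D.f`) — UNCONDITIONALLY:
`BSD(E,p)` holds by the parity closure above, and the additive-p3 seat's
`X4.not_kuriharaUnitAt_of_bsdp_of_dvd_tamagawaProduct` (granted `BSD(E,p)` and `p ∣ ∏ c_ℓ`, a unit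
`δ̃_n` would contradict Kim's equality clause) finishes. In Kim's language: `∂^{(∞)}(δ̃) = 1 = ord_p
∏ c_ℓ` on these rows, i.e. Conjecture 1.10 holds there (forced: `length Ш[p^∞] = 1 − ∂^{(∞)}` is
even and non-negative). Binders as in the two ingredients (both Kim facts, the period transfer
`hper` of the unit-Kurihara-number fact). [cite: Kim2022StructureSelmer, Thm. 1.9 (6) and Conj. 1.10 (PDF p. 8)]
[cite: SilvermanAEC2009, Thm. X.4.14] -/
theorem X4RankZero.not_kuriharaUnitAt_of_casselsTate_of_padicValNat_tamagawaProduct_eq_one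
    (hCT : exists_casselsTate_pairing (K := ℚ))
    (hKim : Kim2026.rankZero_padicValNat_sha_le_of_maninConstant)
    (hKimU : Kim2022_rankZero_padicValRat_sha_of_kuriharaNumber_ne_zero_of_maninConstant)
    (hGZK : rank_eq_analyticRank_of_analyticRank_le_one) (hmod : hasEntireLFunction_rat)
    (hp : 5 ≤ p) (hr : W.analyticRank = 0) (hX : ClassX4 W p) (hsurj : Surj W p)
    {N : ℕ} [NeZero N] (D : ModularParametrizationData W N) (hc : ¬ (p : ℤ) ∣ D.maninConstant)
    (hper : ∃ u : ℚ, ‖(u : ℚ_[p])‖ = 1 ∧ W.realPeriodRat = u * plusPeriod D.f)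
    (htam1 : p ∣ W.tamagawaProduct) (htam2 : ¬ p ^ 2 ∣ W.tamagawaProduct)
    {q : ℚ} (hq : shaAn W = (q : ℂ)) (hv : padicValRat p q = 0) :
    ¬ X4.KuriharaUnitAt W p D.f :=
  X4.not_kuriharaUnitAt_of_bsdp_of_dvd_tamagawaProduct W p hKimU hGZK hmod hp hX hsurj hr D hc hper
    htam1
    (X4RankZero.bsdp_of_casselsTate_of_not_sq_dvd_tamagawaProduct W p hCT hKim hGZK hmod hp hr hX
      hsurj D hc htam2 hq hv)

end Summit.BirchSwinnertonDyer.Rank1Residual.Additive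

end
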